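import Mathlib

/-!
# The single-frame SLOT SYZYGY (hsemireg-semihom-2 g8): the Mukai slot column is minus two sector columns

A kernel theorem about the LETTER model of the (U2) non-box semi-homogeneous alphabets (g1–g7 of
`hsemireg-semihom-2`; memo `MUKAI-SLOT-SYZYGY-U2-semihom2-g8.md`).  A letter is a slope
`S = Σ_k λ_k u_k u_k^*` built from vectors `u_k ∈ R⁸`; by Cauchy–Binet its degree-4 class has entries
`(∧⁴S)[K,L] = Σ_A λ^A ψ_A[K]·σ(ψ_A[L])` over the 4-subsets `A` of the vectors, where `ψ_A[K]` is the
`4 × 4` minor of the `8 × 4` matrix `[u_a]_{a∈A}` on the rows `K` (`pluecker`) and `σ` is complex conjugation.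
The seed slot is `μ = (0246, 1357)`.

**Theorem (slot syzygy, `slot_syzygy`).**  Let `x y z : R` and let every column `u` of `A` be either
`e₀`-free (`u 0 = 0`) or SEAM-ADAPTED (`y·u₁ = x·u₂`, `z·u₂ = y·u₃`, `u₅ = u₇ = 0`).  Then
`ψ_A[0246] = 0` or `y z·ψ_A[1257] − y²·ψ_A[1357] + x y·ψ_A[2357] = 0`.
*Proof.* The second expression is the determinant of the `4 × 4` SEAM MATRIX with rows
`(y X₁ − x X₂, z X₂ − y X₃, X₅, X₇)` applied to the four columns (`det_seamMatrix`, Leibniz expansion + `ring`);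
a seam-adapted column is a zero column of it; and if no column is seam-adapted then every column is `e₀`-free,
so row `0` of the `0246`-minor vanishes. ∎

**Chain frame (`chainFrame_slot_syzygy`).**  The block-1 vectors `θ e₀ − e₁ + ι e₂ − ι e₃` of the (U2) chain frame
(copy 1: `ι = 1`, `θ = i^s`; copy 2 = `Γ`·copy 1 with `Γ = diag(1,1,i,i,1,1,1,1)`: `ι = i`) are seam-adapted for
`(x,y,z) = (−1, ι, −ι)`, and every other frame vector (blocks 2–4, and indeed ANY vector with `u 0 = 0`, of any
"rank pattern") is `e₀`-free; hence for every such 4-subset: `ψ[0246] = 0 ∨ ι ψ[1257] + ι ψ[1357] + ψ[2357] = 0`,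
and at the class level (`chainFrame_entry_law`, phase `ι σ(ι) = 1`):
`E(0246,1357) = − E(0246,1257) − ι · E(0246,2357)` for every letter, hence for every signed design
(`design_slot_law`).  CONSEQUENCES recorded in the memo: (i) g5 §8.3 SINGLE-FRAME MUKAI LAW («rank 53 = 53»)
and check-class-1's 2-term certificate `col(0246,1357) = −col(0246,1257) − col(0246,2357)` (26 260/26 260 rows) are
this identity summed — one frame is μ-dead for every alphabet of letters on `{block 1} ∪ {u : u 0 = 0}`, any rank,
any signs, real or complex coefficients, as soon as the TWO degree-4 cleanliness functionals `(0246,1257)`,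
`(0246,2357)` vanish; (ii) the two-copy μ-TRANSFER LAW (`mu_transfer`, `twoCopy_mu_transfer`):
for a two-copy design clean on those two functionals, `μ = (i − 1)·F₍₀₂₄₆,₂₃₅₇₎(d₁) = (1 − i)·F₍₀₂₄₆,₂₃₅₇₎(d₂)`,
so `μ ∈ (1−i)ℤ[i]` for integer designs (BE-2: `64 − 64i`, BE-2(K=2): `128 − 128i`, R3 certificate: `1 − i`, all
reproduced exactly in `g8/data/mu-transfer-designs.json`).

STATUS WORD: class-level letter linear algebra (letters ≠ sheaves ≠ SEED); evidence-grade; nothing here is a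
step toward HC ∕ HC_CM ∕ HC_AV ∕ №4 ∕ 26512 ∕ 18881 ∕ H2.  D-0145 line: `stub_rung_pad4_seedAt` UNTOUCHED.
Mathlib only; no `sorry`, no new axioms, no instances, no notation.
-/

set_option linter.dupNamespace false

namespace Summit.HodgeConjecture.HodgeConjecture.Cruxes.BlochSeedDiscOne.SingleFrameSlotSyzygy

open Matrix

section General

variable {R : Type*} [CommRing R]

/-! ## §1 Plücker coordinates of four vectors in `R⁸` and the seam matrix -/

/-- The `8 × 4` matrix whose columns are the four vectors `A 0, …, A 3`. -/
def colMatrix (A : Fin 4 → Fin 8 → R) : Matrix (Fin 8) (Fin 4) R := Matrix.of fun r c => A c r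

/-- Plücker coordinate `ψ_A[K]`: the `4 × 4` minor of `colMatrix A` on the rows `K 0, …, K 3`. -/
def pluecker (A : Fin 4 → Fin 8 → R) (K : Fin 4 → Fin 8) : R := ((colMatrix A).submatrix K id).det

/-- Row set `{0,2,4,6}` (the `I₀` side of the slot). -/
def r0246 : Fin 4 → Fin 8 := ![0, 2, 4, 6]
/-- Row set `{1,3,5,7}` (the `J₀` side of the slot). -/
def r1357 : Fin 4 → Fin 8 := ![1, 3, 5, 7]
/-- Row set `{1,2,5,7}`. -/
def r1257 : Fin 4 → Fin 8 := ![1, 2, 5, 7]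
/-- Row set `{2,3,5,7}`. -/
def r2357 : Fin 4 → Fin 8 := ![2, 3, 5, 7]

/-- The SEAM MATRIX: the rows `(y X₁ − x X₂, z X₂ − y X₃, X₅, X₇)` evaluated on the four columns of `A`. -/
def seamMatrix (x y z : R) (A : Fin 4 → Fin 8 → R) : Matrix (Fin 4) (Fin 4) R :=
  Matrix.of ![fun c => y * A c 1 - x * A c 2, fun c => z * A c 2 - y * A c 3, fun c => A c 5,
    fun c => A c 7]

/-- A column `u` is SEAM-ADAPTED for `(x,y,z)`: it is killed by the four seam rows. -/
def SeamAdapted (x y z : R) (u : Fin 8 → R) : Prop :=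
  y * u 1 = x * u 2 ∧ z * u 2 = y * u 3 ∧ u 5 = 0 ∧ u 7 = 0

private theorem succAbove_two_two : Fin.succAbove (2 : Fin 4) (2 : Fin 3) = 3 := by decide
private theorem succAbove_three_two : Fin.succAbove (3 : Fin 4) (2 : Fin 3) = 2 := by decide
private theorem succAbove_one_two : Fin.succAbove (1 : Fin 4) (2 : Fin 3) = 3 := by decide

/-- Leibniz expansion of a `4 × 4` determinant (same bookkeeping lemma as in
`Literature/AlgebraicGeometry/LineGeometry/KleinCorrespondence.lean`). -/
private theorem det_fin_four (M : Matrix (Fin 4) (Fin 4) R) :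
    M.det =
      M 0 0 * M 1 1 * M 2 2 * M 3 3 - M 0 0 * M 1 1 * M 2 3 * M 3 2
        - M 0 0 * M 1 2 * M 2 1 * M 3 3 + M 0 0 * M 1 2 * M 2 3 * M 3 1
        + M 0 0 * M 1 3 * M 2 1 * M 3 2 - M 0 0 * M 1 3 * M 2 2 * M 3 1
        - M 0 1 * M 1 0 * M 2 2 * M 3 3 + M 0 1 * M 1 0 * M 2 3 * M 3 2
        + M 0 1 * M 1 2 * M 2 0 * M 3 3 - M 0 1 * M 1 2 * M 2 3 * M 3 0
        - M 0 1 * M 1 3 * M 2 0 * M 3 2 + M 0 1 * M 1 3 * M 2 2 * M 3 0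
        + M 0 2 * M 1 0 * M 2 1 * M 3 3 - M 0 2 * M 1 0 * M 2 3 * M 3 1
        - M 0 2 * M 1 1 * M 2 0 * M 3 3 + M 0 2 * M 1 1 * M 2 3 * M 3 0
        + M 0 2 * M 1 3 * M 2 0 * M 3 1 - M 0 2 * M 1 3 * M 2 1 * M 3 0
        - M 0 3 * M 1 0 * M 2 1 * M 3 2 + M 0 3 * M 1 0 * M 2 2 * M 3 1
        + M 0 3 * M 1 1 * M 2 0 * M 3 2 - M 0 3 * M 1 1 * M 2 2 * M 3 0
        - M 0 3 * M 1 2 * M 2 0 * M 3 1 + M 0 3 * M 1 2 * M 2 1 * M 3 0 := by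
  rw [Matrix.det_succ_row_zero]
  simp [Fin.sum_univ_succ, Matrix.det_fin_three, succAbove_two_two, succAbove_three_two,
    succAbove_one_two]
  ring

/-- **The seam determinant.** `det(seamMatrix) = y z·ψ[1257] − y²·ψ[1357] + x y·ψ[2357]`
(multilinear expansion of the two binomial rows; the term `ψ[2257]`-type repeats vanish). -/
theorem det_seamMatrix (x y z : R) (A : Fin 4 → Fin 8 → R) :
    (seamMatrix x y z A).det =
      y * z * pluecker A r1257 - y ^ 2 * pluecker A r1357 + x * y * pluecker A r2357 := by
  simp only [pluecker, det_fin_four]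
  simp [seamMatrix, colMatrix, r1257, r1357, r2357, Matrix.submatrix_apply]
  ring

/-- A seam-adapted column is a zero column of the seam matrix, so its determinant vanishes. -/
theorem det_seamMatrix_eq_zero {x y z : R} {A : Fin 4 → Fin 8 → R} (c : Fin 4)
    (hc : SeamAdapted x y z (A c)) : (seamMatrix x y z A).det = 0 := by
  obtain ⟨h1, h2, h5, h7⟩ := hc
  apply Matrix.det_eq_zero_of_column_eq_zero c
  intro i
  fin_cases i
  · show y * A c 1 - x * A c 2 = 0
    rw [h1, sub_self]
  · show z * A c 2 - y * A c 3 = 0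
    rw [h2, sub_self]
  · show A c 5 = 0
    exact h5
  · show A c 7 = 0
    exact h7

/-- If every column is `e₀`-free, the `0246`-minor has a zero row. -/
theorem pluecker_r0246_eq_zero {A : Fin 4 → Fin 8 → R} (h : ∀ c, A c 0 = 0) :
    pluecker A r0246 = 0 := by
  apply Matrix.det_eq_zero_of_row_eq_zero 0
  intro j
  simp [colMatrix, r0246, h]

/-! ## §2 The slot syzygy -/

/-- **SLOT SYZYGY (general seam).**  If every column of `A` is `e₀`-free or seam-adapted for `(x,y,z)`, then
`ψ_A[0246] = 0` or `y z·ψ_A[1257] − y²·ψ_A[1357] + x y·ψ_A[2357] = 0`. -/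
theorem slot_syzygy (x y z : R) (A : Fin 4 → Fin 8 → R)
    (hA : ∀ c, A c 0 = 0 ∨ SeamAdapted x y z (A c)) :
    pluecker A r0246 = 0 ∨
      y * z * pluecker A r1257 - y ^ 2 * pluecker A r1357 + x * y * pluecker A r2357 = 0 := by
  by_cases h : ∃ c, SeamAdapted x y z (A c)
  · obtain ⟨c, hc⟩ := h
    right
    rw [← det_seamMatrix]
    exact det_seamMatrix_eq_zero c hc
  · exact Or.inl (pluecker_r0246_eq_zero fun c => (hA c).resolve_right fun hc => h ⟨c, hc⟩)

/-- Product form of the slot syzygy. -/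
theorem slot_syzygy_mul (x y z : R) (A : Fin 4 → Fin 8 → R)
    (hA : ∀ c, A c 0 = 0 ∨ SeamAdapted x y z (A c)) :
    pluecker A r0246 *
      (y * z * pluecker A r1257 - y ^ 2 * pluecker A r1357 + x * y * pluecker A r2357) = 0 := by
  rcases slot_syzygy x y z A hA with h | h
  · rw [h, zero_mul]
  · rw [h, mul_zero]

/-! ## §3 The (U2) chain frame: block-1 vectors with seam phase `ι` -/

/-- Block-1 vector of the (U2) chain frame with apex entry `θ` and seam phase `ι`:
`θ e₀ − e₁ + ι e₂ − ι e₃` (copy 1: `ι = 1`, `θ = i^s`; copy 2: `ι = i`). -/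
def blockOne (θ ι : R) : Fin 8 → R := ![θ, -1, ι, -ι, 0, 0, 0, 0]

theorem blockOne_apply_one (θ ι : R) : blockOne θ ι 1 = -1 := rfl
theorem blockOne_apply_two (θ ι : R) : blockOne θ ι 2 = ι := rfl
theorem blockOne_apply_three (θ ι : R) : blockOne θ ι 3 = -ι := rfl
theorem blockOne_apply_five (θ ι : R) : blockOne θ ι 5 = 0 := rfl
theorem blockOne_apply_seven (θ ι : R) : blockOne θ ι 7 = 0 := rfl

/-- Block-1 vectors are seam-adapted for `(x,y,z) = (−1, ι, −ι)`. -/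
theorem blockOne_seamAdapted (θ ι : R) : SeamAdapted (-1) ι (-ι) (blockOne θ ι) := by
  refine ⟨?_, ?_, blockOne_apply_five θ ι, blockOne_apply_seven θ ι⟩
  · rw [blockOne_apply_one, blockOne_apply_two]; ring
  · rw [blockOne_apply_two, blockOne_apply_three]; ring

/-- The frame hypothesis: every column is `e₀`-free or a block-1 vector with seam phase `ι`. -/
def ChainColumns (ι : R) (A : Fin 4 → Fin 8 → R) : Prop :=
  ∀ c, A c 0 = 0 ∨ ∃ θ, A c = blockOne θ ι

theorem chainColumns_seam {ι : R} {A : Fin 4 → Fin 8 → R} (hA : ChainColumns ι A) :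
    ∀ c, A c 0 = 0 ∨ SeamAdapted (-1) ι (-ι) (A c) := fun c =>
  (hA c).imp_right fun ⟨θ, hθ⟩ => hθ ▸ blockOne_seamAdapted θ ι

/-- **SLOT SYZYGY on the chain frame.**  For a unit seam phase `ι` and every 4-subset of
`{block-1 vectors with phase ι} ∪ {u : u 0 = 0}`:  `ψ[0246] = 0 ∨ ι ψ[1257] + ι ψ[1357] + ψ[2357] = 0`. -/
theorem chainFrame_slot_syzygy (ι : R) (hι : IsUnit ι) (A : Fin 4 → Fin 8 → R)
    (hA : ChainColumns ι A) :
    pluecker A r0246 = 0 ∨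
      ι * pluecker A r1257 + ι * pluecker A r1357 + pluecker A r2357 = 0 := by
  rcases slot_syzygy (-1) ι (-ι) A (chainColumns_seam hA) with h | h
  · exact Or.inl h
  · right
    have hneg : IsUnit (-ι) := hι.neg
    have h' : (-ι) * (ι * pluecker A r1257 + ι * pluecker A r1357 + pluecker A r2357) = 0 := by
      rw [← h]; ring
    exact hneg.mul_right_eq_zero.mp h'

/-- Sharper first branch: a 4-subset CONTAINING a block-1 vector (unit phase `ι`) has
`ι ψ[1257] + ι ψ[1357] + ψ[2357] = 0` outright (no hypothesis on the other three columns). -/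
theorem seamSum_eq_zero_of_blockOne (ι : R) (hι : IsUnit ι) (A : Fin 4 → Fin 8 → R) (c : Fin 4)
    (θ : R) (hc : A c = blockOne θ ι) :
    ι * pluecker A r1257 + ι * pluecker A r1357 + pluecker A r2357 = 0 := by
  have h : (seamMatrix (-1) ι (-ι) A).det = 0 :=
    det_seamMatrix_eq_zero c (hc ▸ blockOne_seamAdapted θ ι)
  rw [det_seamMatrix] at h
  have h' : (-ι) * (ι * pluecker A r1257 + ι * pluecker A r1357 + pluecker A r2357) = 0 := by
    rw [← h]; ring
  exact hι.neg.mul_right_eq_zero.mp h'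

/-- Copy 1 (`ι = 1`): `ψ[0246] = 0 ∨ ψ[1257] + ψ[1357] + ψ[2357] = 0` — the PENCIL TARGET set by
check-class-1 (LEDGER-class row 216) for semihom-2, for ALL frame 4-subsets (g1 RESULT-U2-K1A §3 had the LINE letters). -/
theorem copyOne_slot_syzygy (A : Fin 4 → Fin 8 → R) (hA : ChainColumns (1 : R) A) :
    pluecker A r0246 = 0 ∨ pluecker A r1257 + pluecker A r1357 + pluecker A r2357 = 0 := by
  rcases chainFrame_slot_syzygy 1 isUnit_one A hA with h | h
  · exact Or.inl h
  · right; simpa using h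

/-! ## §4 Class level: entries `ψ[K]·σ(ψ[L])` and signed designs -/

/-- Degree-4 class entry `(K,L)` of the letter on the 4-frame `A`: `ψ_A[K] · σ(ψ_A[L])`
(`σ` = complex conjugation in the application; any ring endomorphism here). -/
def entry (σ : R →+* R) (A : Fin 4 → Fin 8 → R) (K L : Fin 4 → Fin 8) : R :=
  pluecker A K * σ (pluecker A L)

/-- Entry form of the slot syzygy: `σ(ι)·E(0246,1257) + σ(ι)·E(0246,1357) + E(0246,2357) = 0`. -/
theorem chainFrame_entry_syzygy (σ : R →+* R) (ι : R) (hι : IsUnit ι) (A : Fin 4 → Fin 8 → R)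
    (hA : ChainColumns ι A) :
    σ ι * entry σ A r0246 r1257 + σ ι * entry σ A r0246 r1357 + entry σ A r0246 r2357 = 0 := by
  unfold entry
  rcases chainFrame_slot_syzygy ι hι A hA with h | h
  · rw [h]; ring
  · have hσ := congrArg σ h
    simp only [map_add, map_mul, map_zero] at hσ
    linear_combination (pluecker A r0246) * hσ

/-- **Slot law for one letter** (unitary phase `ι·σ(ι) = 1`):
`E(0246,1357) = − E(0246,1257) − ι·E(0246,2357)`. -/
theorem chainFrame_entry_law (σ : R →+* R) (ι : R) (hιι : ι * σ ι = 1) (A : Fin 4 → Fin 8 → R)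
    (hA : ChainColumns ι A) :
    entry σ A r0246 r1357 = - entry σ A r0246 r1257 - ι * entry σ A r0246 r2357 := by
  have hι : IsUnit ι := ⟨⟨ι, σ ι, hιι, (mul_comm _ _).trans hιι⟩, rfl⟩
  have h := chainFrame_entry_syzygy σ ι hι A hA
  linear_combination ι * h - (entry σ A r0246 r1257 + entry σ A r0246 r1357) * hιι

/-- Degree-4 functional `(K,L)` of a signed design: letters `a ∈ s` on 4-frames `A a` with coefficients `w a`
(`w a` = multiplicity × `λ^A`, the product of the charges; any ring elements here). -/
def designEntry (σ : R →+* R) {α : Type*} (s : Finset α) (w : α → R) (A : α → Fin 4 → Fin 8 → R)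
    (K L : Fin 4 → Fin 8) : R :=
  ∑ a ∈ s, w a * entry σ (A a) K L

/-- **Slot law for a design on one frame**: `F(0246,1357) = − F(0246,1257) − ι·F(0246,2357)`.
In particular ONE frame is μ-dead as soon as the two cleanliness functionals `(0246,1257)`, `(0246,2357)`
vanish (g5 §8.3 «rank 53 = 53», now for every alphabet on `{block 1} ∪ {e₀-free vectors}`). -/
theorem design_slot_law (σ : R →+* R) (ι : R) (hιι : ι * σ ι = 1) {α : Type*} (s : Finset α)
    (w : α → R) (A : α → Fin 4 → Fin 8 → R) (hA : ∀ a ∈ s, ChainColumns ι (A a)) :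
    designEntry σ s w A r0246 r1357 =
      - designEntry σ s w A r0246 r1257 - ι * designEntry σ s w A r0246 r2357 := by
  unfold designEntry
  rw [Finset.mul_sum, ← Finset.sum_neg_distrib, ← Finset.sum_sub_distrib]
  refine Finset.sum_congr rfl fun a ha => ?_
  rw [chainFrame_entry_law σ ι hιι (A a) (hA a ha)]
  ring

/-- Single-frame μ-death: clean on `(0246,1257)` and `(0246,2357)` ⇒ `μ = F(0246,1357) = 0`. -/
theorem design_mu_eq_zero (σ : R →+* R) (ι : R) (hιι : ι * σ ι = 1) {α : Type*} (s : Finset α)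
    (w : α → R) (A : α → Fin 4 → Fin 8 → R) (hA : ∀ a ∈ s, ChainColumns ι (A a))
    (hF : designEntry σ s w A r0246 r1257 = 0) (hG : designEntry σ s w A r0246 r2357 = 0) :
    designEntry σ s w A r0246 r1357 = 0 := by
  rw [design_slot_law σ ι hιι s w A hA, hF, hG]; ring

/-! ## §5 Two copies: the μ-transfer law -/

/-- **μ-TRANSFER (pure algebra).**  Per-copy slot laws `μ_c = −F_c − ι_c G_c` and cleanliness of the two-copy
design on `F = (0246,1257)` and `G = (0246,2357)` give `μ₁ + μ₂ = (ι₂ − ι₁)·G₁ = (ι₁ − ι₂)·G₂`. -/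
theorem mu_transfer {μ₁ μ₂ F₁ F₂ G₁ G₂ ι₁ ι₂ : R} (h₁ : μ₁ = -F₁ - ι₁ * G₁)
    (h₂ : μ₂ = -F₂ - ι₂ * G₂) (hF : F₁ + F₂ = 0) (hG : G₁ + G₂ = 0) :
    μ₁ + μ₂ = (ι₂ - ι₁) * G₁ ∧ μ₁ + μ₂ = (ι₁ - ι₂) * G₂ := by
  constructor
  · linear_combination h₁ + h₂ - hF - ι₂ * hG
  · linear_combination h₁ + h₂ - hF - ι₁ * hG

/-- **μ-TRANSFER LAW for two-copy designs of single-frame letters** (copy phases `ι₁`, `ι₂` with `ι σ(ι) = 1`):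
if the design is clean on `(0246,1257)` and `(0246,2357)` then
`μ = F₁(0246,1357) + F₂(0246,1357) = (ι₂ − ι₁) · F₁(0246,2357)`. -/
theorem twoCopy_mu_transfer (σ : R →+* R) (ι₁ ι₂ : R) (h₁ : ι₁ * σ ι₁ = 1) (h₂ : ι₂ * σ ι₂ = 1)
    {α β : Type*} (s₁ : Finset α) (w₁ : α → R) (A₁ : α → Fin 4 → Fin 8 → R)
    (s₂ : Finset β) (w₂ : β → R) (A₂ : β → Fin 4 → Fin 8 → R)
    (hA₁ : ∀ a ∈ s₁, ChainColumns ι₁ (A₁ a)) (hA₂ : ∀ b ∈ s₂, ChainColumns ι₂ (A₂ b))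
    (hF : designEntry σ s₁ w₁ A₁ r0246 r1257 + designEntry σ s₂ w₂ A₂ r0246 r1257 = 0)
    (hG : designEntry σ s₁ w₁ A₁ r0246 r2357 + designEntry σ s₂ w₂ A₂ r0246 r2357 = 0) :
    designEntry σ s₁ w₁ A₁ r0246 r1357 + designEntry σ s₂ w₂ A₂ r0246 r1357 =
      (ι₂ - ι₁) * designEntry σ s₁ w₁ A₁ r0246 r2357 :=
  (mu_transfer (design_slot_law σ ι₁ h₁ s₁ w₁ A₁ hA₁) (design_slot_law σ ι₂ h₂ s₂ w₂ A₂ hA₂)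
    hF hG).1

end General

/-! ## §6 The complex instance: copy 1 (`ι = 1`) and copy 2 (`ι = i`), `σ` = conjugation -/

section ComplexFrame

/-- Copy 1 phase: `1 · conj 1 = 1`. -/
theorem copyOne_phase : (1 : ℂ) * starRingEnd ℂ 1 = 1 := by simp

/-- Copy 2 phase: `i · conj i = 1`. -/
theorem copyTwo_phase : Complex.I * starRingEnd ℂ Complex.I = 1 := by
  simp [Complex.conj_I]

/-- **The two-copy μ-transfer law over `ℂ`** (U2 chain frames, copy 2 = `Γ`·copy 1): for every signed design of
single-frame letters (any ranks/charges folded into the coefficients, any `e₀`-free companions) that is clean on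
`(0246,1257)` and `(0246,2357)`,  `μ = (i − 1) · F₁(0246,2357) = −(1 − i) · F₁(0246,2357)`.
(BE-2: `F₁(0246,2357) = −64`, `μ = 64 − 64i`; R3 certificate: `F₁ = −1`, `μ = 1 − i`.) -/
theorem twoCopy_mu_transfer_complex {α β : Type*} (s₁ : Finset α) (w₁ : α → ℂ)
    (A₁ : α → Fin 4 → Fin 8 → ℂ) (s₂ : Finset β) (w₂ : β → ℂ) (A₂ : β → Fin 4 → Fin 8 → ℂ)
    (hA₁ : ∀ a ∈ s₁, ChainColumns (1 : ℂ) (A₁ a)) (hA₂ : ∀ b ∈ s₂, ChainColumns Complex.I (A₂ b))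
    (hF : designEntry (starRingEnd ℂ) s₁ w₁ A₁ r0246 r1257 +
        designEntry (starRingEnd ℂ) s₂ w₂ A₂ r0246 r1257 = 0)
    (hG : designEntry (starRingEnd ℂ) s₁ w₁ A₁ r0246 r2357 +
        designEntry (starRingEnd ℂ) s₂ w₂ A₂ r0246 r2357 = 0) :
    designEntry (starRingEnd ℂ) s₁ w₁ A₁ r0246 r1357 +
        designEntry (starRingEnd ℂ) s₂ w₂ A₂ r0246 r1357 =
      (Complex.I - 1) * designEntry (starRingEnd ℂ) s₁ w₁ A₁ r0246 r2357 :=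
  twoCopy_mu_transfer (starRingEnd ℂ) 1 Complex.I copyOne_phase copyTwo_phase s₁ w₁ A₁ s₂ w₂ A₂
    hA₁ hA₂ hF hG

/-- Single-frame μ-death over `ℂ`, copy 1: clean on `(0246,1257)`, `(0246,2357)` ⇒ `μ = 0`. -/
theorem copyOne_mu_eq_zero {α : Type*} (s : Finset α) (w : α → ℂ) (A : α → Fin 4 → Fin 8 → ℂ)
    (hA : ∀ a ∈ s, ChainColumns (1 : ℂ) (A a))
    (hF : designEntry (starRingEnd ℂ) s w A r0246 r1257 = 0)
    (hG : designEntry (starRingEnd ℂ) s w A r0246 r2357 = 0) :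
    designEntry (starRingEnd ℂ) s w A r0246 r1357 = 0 :=
  design_mu_eq_zero (starRingEnd ℂ) 1 copyOne_phase s w A hA hF hG

end ComplexFrame

end Summit.HodgeConjecture.HodgeConjecture.Cruxes.BlochSeedDiscOne.SingleFrameSlotSyzygy
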